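import Literature.AlgebraicGeometry.GroupSchemes.AffineGroupSchemeOfHopfAlgebra
import Literature.RingTheory.HopfAlgebra.FiniteDualHopfAlgebra
import Literature.RingTheory.HopfAlgebra.FiniteDualBaseChange
import Literature.RingTheory.HopfAlgebra.FiniteDualPoints
import Mathlib.AlgebraicGeometry.Morphisms.Finite
import Mathlib.AlgebraicGeometry.Morphisms.Flat
import HarnessLib

/-!
# The Cartier dual `G^D = Spec Γ(G, 𝒪_G)^*` of a finite free commutative group scheme (Tate 1997 §(3.8); Görtz–Wedhorn II §(27.2))

Layer `Literature/AlgebraicGeometry/GroupSchemes`, namespace `Literature.AlgebraicGeometry.GroupSchemes.AffineGroupScheme` (continues ★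
`AffineGroupSchemeHopfAlgebra` p844646 — `Alg G = Γ(G, 𝒪_G)` as a commutative Hopf algebra — and ★ `AffineGroupSchemeOfHopfAlgebra` p845155 —
`grpObjOfHopfAlgebra R H : GrpObj (specOver R H)`, `coordMulEquiv`).  DEFINITIONS (one `def` carrier `DualAlg G` with its `CommRing` ∕ `Algebra` ∕
`HopfAlgebra` instances — instances ONLY on this file's own carrier, the ★ pattern of `Alg` —, the scheme `cartierDual G`, its group object
`cartierDualGrpObj G`, the points isomorphism `cartierDualPointsMulEquiv`) + theorems; no notation, no named fact, no `sorry`.  Cell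
`hodgecm-mathlib` (D-0151), programme P6 «MOD», HEART organ ST-0 gap **(g1) «scheme dress of Cartier duality»** (A-p17 (g24) census 15:19:36Z,
LEAD F0P6-plan (g0) M-13 (2); B-p04 (g37), FILE 1 of 3).  Count-neutral Mathlib-side capital: HC_CM is proved only modulo the 7 printed
citations until rung 0 closes; nothing here bears on it.

THE PRINT ([Tate1997FiniteFlatGroupSchemes] §(3.8) «The dual Hopf algebra and Cartier duality», pp. 144–146; [GortzWedhorn2023] §(27.2)): for a
commutative group scheme `G = Spec A` finite and locally free over `R`, the linear dual `A′ := Hom_R(A, R)` with the transposed structure maps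
is again a commutative cocommutative Hopf `R`-algebra, finite locally free of the same rank, and `G^D := Spec A′` is the CARTIER DUAL of `G`;
its `S`-points are `Hom_{S-grp}(G_S, 𝔾_{m,S})` = the group-like elements of `A ⊗_R S`.  The tree has the whole HOPF side (★ CD1
`FiniteDual.hopfAlgebra`, CD2-bidual `exists_bialgEquiv_bidual`, CD2-bc `isBaseChange_dual_baseChange`, CD2-pts
`existsUnique_isGroupLikeElem_of_algHom`, CD3 `FiniteDualQuotient ∕ Subalgebra`) on Mathlib's convolution carrier `WithConv (Module.Dual R B)`;
THIS FILE is the scheme dress (finite locally free enters as finite FREE, as in every ★ `FiniteDual*` file):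

* §1 **`DualAlg G := WithConv (Module.Dual R (Alg G))`** with `CommRing` (Mathlib `LinearMap.convCommRing`, cocommutativity of `Alg G` from
  ★ `Alg.isCocomm`) and `Algebra R` (Mathlib `LinearMap.convAlgebra`).
* §2 **`cartierDual G := specOver R (DualAlg G)`**, `isAffine_cartierDual_left`, `algCartierDualEquiv : Alg (cartierDual G) ≃ₐ[R] DualAlg G`
  (★ `algSpecOverEquiv`).
* §3 for `Alg G` finite FREE: `HopfAlgebra R (DualAlg G)` (★ `FiniteDual.hopfAlgebra`), `DualAlg.free ∕ finite ∕ isCocomm`,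
  **`DualAlg.finrank_eq : finrank R (DualAlg G) = finrank R (Alg G)`** (★ `finrank_withConv_dual`), **`isFinite_cartierDual_hom`**,
  **`flat_cartierDual_hom`**, `free_ ∕ finite_alg_cartierDual`, **`finrank_alg_cartierDual : finrank R (Alg (cartierDual G)) = finrank R (Alg G)`**
  («`G^D` has the rank of `G`»).
* §4 **`cartierDualGrpObj G : GrpObj (cartierDual G)`** (`grpObjOfHopfAlgebra`, reducible, installed with `letI`), **`isCommMonObj_cartierDual`**.
* §5 points: **`cartierDualPointsMulEquiv G T : (T ⟶ cartierDual G) ≃* WithConv (DualAlg G →ₐ[R] Alg T)`** for EVERY `R`-scheme `T`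
  (★ `coordMulEquiv`), and on affine test objects the CHARACTER reading **`existsUnique_isGroupLikeElem_of_point`**: a point
  `u : Spec R′ → G^D` over `R` is a unique group-like element of `R′ ⊗_R Γ(G, 𝒪_G)` (= a character `G_{R′} → 𝔾_{m,R′}`; ★ CD2-pts), and
  conversely `exists_point_of_isGroupLikeElem`.

* §6 (ED. 2, append-only) INSTANCES on the file's own carriers `DualAlg G` (`Module.Free ∕ Finite`, `IsCocomm`) and `cartierDual G` (`GrpObj`,
  `IsCommMonObj`, `IsAffine ….left`, `Module.Free ∕ Finite R (Alg (cartierDual G))`, `IsFinite ∕ Flat ….hom`) so that `(G^D)^D`, `DualAlg (G^D)` and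
  products of `G^D` elaborate by instance search; `cartierDual_cartierDual_def`.

NOT here (sequel files ★ `AffineGroupSchemeBialgHom`, ★ `CartierDualMap`, `CartierDualBidual`): «`Spec` of a bialgebra hom is a hom of group
objects», functoriality `G ↦ G^D`, the bidual `(G^D)^D ≅ G`, base change in Yoneda form.

## References
* [Tate1997FiniteFlatGroupSchemes] J. Tate, *Finite flat group schemes*, in: Modular Forms and Fermat's Last Theorem (1997), §(3.8) pp. 144–146.
* [GortzWedhorn2023] U. Görtz, T. Wedhorn, *Algebraic Geometry II* (2023), §(27.2), (27.2.1), Def. 27.6 (pp. 606–607).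
-/

set_option autoImplicit false

-- Mathlib's `Over`/`Scheme` APIs are stated across semireducible wrappers (as in the ★ `GroupSchemes/*` files).
set_option backward.isDefEq.respectTransparency false

universe u

open CategoryTheory CategoryTheory.Limits AlgebraicGeometry MonoidalCategory CartesianMonoidalCategory TensorProduct WithConv

noncomputable section

namespace Literature.AlgebraicGeometry.GroupSchemes

namespace AffineGroupScheme

open scoped MonObj

open Literature.AlgebraicGeometry.Motives Literature.NumberTheory.DiophantineGeometry Literature.RingTheory.HopfAlgebra

variable {R : Type u} [CommRing R] (G : SchemeOver R) [GrpObj G] [IsCommMonObj G] [IsAffine G.left]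

/-! ## §1 The Cartier dual algebra `Γ(G, 𝒪_G)^*` -/

/-- **The Cartier dual algebra** `A′ = Hom_R(A, R)` of `A = Γ(G, 𝒪_G)`, on Mathlib's convolution carrier `WithConv (Module.Dual R (Alg G))`
(a `def` carrier, so that the ring and Hopf structures below are attached to it only; every ★ `FiniteDual*` statement applies to it by
`rfl`).  Its multiplication is the convolution `(f ⋆ g)(a) = Σ f(a₁) g(a₂)` dual to `Δ_A`. [cite: Tate1997FiniteFlatGroupSchemes, §(3.8) p. 144] -/
def DualAlg : Type u := WithConv (Module.Dual R (Alg G))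

omit [GrpObj G] [IsCommMonObj G] [IsAffine G.left] in
/-- `DualAlg G` IS `WithConv (Module.Dual R (Alg G))`. [cite: Tate1997FiniteFlatGroupSchemes, §(3.8) p. 144] -/
theorem DualAlg_def : DualAlg G = WithConv (Module.Dual R (Alg G)) := rfl

/-- `A′` is a COMMUTATIVE ring: the convolution algebra of the COCOMMUTATIVE coalgebra `Γ(G, 𝒪_G)` of the commutative group scheme `G`
(Mathlib `LinearMap.convCommRing`, ★ `Alg.isCocomm`). [cite: Tate1997FiniteFlatGroupSchemes, §(3.8) p. 144] -/
instance DualAlg.instCommRing : CommRing (DualAlg G) :=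
  haveI := Alg.isCocomm G
  (inferInstance : CommRing (WithConv (Module.Dual R (Alg G))))

/-- `A′` is an `R`-algebra: Mathlib's convolution algebra `LinearMap.convAlgebra` (unit `η ∘ ε_A`).
[cite: Tate1997FiniteFlatGroupSchemes, §(3.8) p. 144] -/
instance DualAlg.instAlgebra : Algebra R (DualAlg G) :=
  (inferInstance : Algebra R (WithConv (Module.Dual R (Alg G))))

/-! ## §2 The scheme `G^D = Spec A′ → Spec R` -/

/-- **The Cartier dual `G^D := Spec Γ(G, 𝒪_G)^*`** of the commutative affine group scheme `G` over `R`, as an `R`-scheme (for the GROUP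
structure, `A = Γ(G, 𝒪_G)` must be finite free: §3). [cite: Tate1997FiniteFlatGroupSchemes, §(3.8) p. 145] -/
def cartierDual : SchemeOver R := specOver R (DualAlg G)

/-- `G^D` IS `specOver R (DualAlg G)`. [cite: Tate1997FiniteFlatGroupSchemes, §(3.8) p. 145] -/
theorem cartierDual_def : cartierDual G = specOver R (DualAlg G) := rfl

/-- The structure map of `G^D` is `Spec (R → A′)`. [cite: Tate1997FiniteFlatGroupSchemes, §(3.8) p. 145] -/
theorem cartierDual_hom : (cartierDual G).hom = Spec.map (CommRingCat.ofHom (algebraMap R (DualAlg G))) := rfl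

/-- `G^D` is an affine scheme (for callers: `haveI := isAffine_cartierDual_left G`). [cite: Tate1997FiniteFlatGroupSchemes, §(3.8) p. 145] -/
theorem isAffine_cartierDual_left : IsAffine (cartierDual G).left := isAffine_specOver_left (DualAlg G)

/-- **`Γ(G^D, 𝒪) ≃ₐ[R] A′`** (★ `algSpecOverEquiv`; the BIALGEBRA form is ★ `algSpecOverBialgEquiv` under `cartierDualGrpObj`).
[cite: Tate1997FiniteFlatGroupSchemes, §(3.8) p. 145] -/
def algCartierDualEquiv : Alg (cartierDual G) ≃ₐ[R] DualAlg G := algSpecOverEquiv (DualAlg G)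

/-- `algCartierDualEquiv` is `Scheme.ΓSpecIso` on elements. [cite: Tate1997FiniteFlatGroupSchemes, §(3.8) p. 145] -/
theorem algCartierDualEquiv_apply (a : Alg (cartierDual G)) :
    algCartierDualEquiv G a = (Scheme.ΓSpecIso (CommRingCat.of (DualAlg G))).hom.hom a := rfl

/-! ## §3 Finite free `Γ(G, 𝒪_G)`: the Hopf algebra `A′`, rank, finiteness and flatness of `G^D` -/

variable [Module.Free R (Alg G)] [Module.Finite R (Alg G)]

/-- **`A′` is a Hopf `R`-algebra** for `A = Γ(G, 𝒪_G)` finite free: `Δ_{A′} = m_A^*`, `ε_{A′} = η_A^*`, `S_{A′} = S_A^*`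
(★ `FiniteDual.hopfAlgebra`, installed on this file's carrier). [cite: Tate1997FiniteFlatGroupSchemes, §(3.8) p. 145] -/
instance DualAlg.instHopfAlgebra : HopfAlgebra R (DualAlg G) :=
  (FiniteDual.hopfAlgebra R (Alg G) : HopfAlgebra R (WithConv (Module.Dual R (Alg G))))

/-- `A′` is a free `R`-module (★ `free_withConv_dual`). [cite: Tate1997FiniteFlatGroupSchemes, §(3.8) p. 144] -/
theorem DualAlg.free : Module.Free R (DualAlg G) := free_withConv_dual (R := R) (A := Alg G)

/-- `A′` is a finite `R`-module (★ `finite_withConv_dual`). [cite: Tate1997FiniteFlatGroupSchemes, §(3.8) p. 144] -/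
theorem DualAlg.finite : Module.Finite R (DualAlg G) := finite_withConv_dual (R := R) (A := Alg G)

/-- **`rank_R A′ = rank_R A`** (★ `finrank_withConv_dual`): the Cartier dual algebra has the rank of `Γ(G, 𝒪_G)`.
[cite: Tate1997FiniteFlatGroupSchemes, §(3.8) p. 145] -/
theorem DualAlg.finrank_eq : Module.finrank R (DualAlg G) = Module.finrank R (Alg G) := finrank_withConv_dual (R := R) (A := Alg G)

/-- `A′` is cocommutative (the dual of the COMMUTATIVE algebra `Γ(G, 𝒪_G)`; ★ `FiniteDual.isCocomm`).
[cite: Tate1997FiniteFlatGroupSchemes, §(3.8) p. 145] -/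
theorem DualAlg.isCocomm : Coalgebra.IsCocomm R (DualAlg G) := FiniteDual.isCocomm R (Alg G)

/-- **`G^D → Spec R` is finite.** [cite: Tate1997FiniteFlatGroupSchemes, §(3.8) p. 145] -/
theorem isFinite_cartierDual_hom : IsFinite (cartierDual G).hom := by
  rw [cartierDual_hom, IsFinite.SpecMap_iff]
  change (algebraMap R (DualAlg G)).Finite
  rw [RingHom.finite_algebraMap]
  exact DualAlg.finite G

/-- **`G^D → Spec R` is flat** (indeed `A′` is free). [cite: Tate1997FiniteFlatGroupSchemes, §(3.8) p. 145] -/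
theorem flat_cartierDual_hom : Flat (cartierDual G).hom := by
  rw [cartierDual_hom, Flat.SpecMap_iff]
  change (algebraMap R (DualAlg G)).Flat
  rw [RingHom.flat_algebraMap_iff]
  haveI := DualAlg.free G
  infer_instance


/-- `Γ(G^D, 𝒪)` is a free `R`-module. [cite: Tate1997FiniteFlatGroupSchemes, §(3.8) p. 145] -/
theorem free_alg_cartierDual : Module.Free R (Alg (cartierDual G)) :=
  haveI := DualAlg.free G
  Module.Free.of_equiv (algCartierDualEquiv G).symm.toLinearEquiv

/-- `Γ(G^D, 𝒪)` is a finite `R`-module. [cite: Tate1997FiniteFlatGroupSchemes, §(3.8) p. 145] -/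
theorem finite_alg_cartierDual : Module.Finite R (Alg (cartierDual G)) :=
  haveI := DualAlg.finite G
  Module.Finite.equiv (algCartierDualEquiv G).symm.toLinearEquiv

/-- **`G^D` has the rank of `G`**: `rank_R Γ(G^D, 𝒪) = rank_R Γ(G, 𝒪)`. [cite: Tate1997FiniteFlatGroupSchemes, §(3.8) p. 145] -/
theorem finrank_alg_cartierDual : Module.finrank R (Alg (cartierDual G)) = Module.finrank R (Alg G) := by
  rw [(algCartierDualEquiv G).toLinearEquiv.finrank_eq, DualAlg.finrank_eq]

/-! ## §4 The group object `G^D` -/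

/-- **The group scheme structure of `G^D`**: the group object of the commutative Hopf algebra `A′` (★ `grpObjOfHopfAlgebra`: `T`-points
multiply by convolution).  A reducible `def`, installed with `letI := cartierDualGrpObj G`. [cite: Tate1997FiniteFlatGroupSchemes, §(3.8) p. 145] -/
@[reducible] def cartierDualGrpObj : GrpObj (cartierDual G) := grpObjOfHopfAlgebra R (DualAlg G)

/-- **`G^D` is a commutative group scheme** (`A′` is cocommutative). [cite: Tate1997FiniteFlatGroupSchemes, §(3.8) p. 145] -/
theorem isCommMonObj_cartierDual : letI := cartierDualGrpObj G; IsCommMonObj (cartierDual G) :=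
  haveI := DualAlg.isCocomm G
  isCommMonObj_grpObjOfHopfAlgebra R (DualAlg G)

/-! ## §5 Points of `G^D`: convolution-invertible maps `A′ → Γ(T)`, i.e. characters of `G` -/

section Points

variable (T : SchemeOver R)

/-- **`G^D(T) ≃* WithConv (A′ →ₐ[R] Γ(T, 𝒪_T))`** for EVERY `R`-scheme `T`: the group of `T`-points of `G^D` (Mathlib's `Hom.group` for
`cartierDualGrpObj`) is the convolution group of `Γ(T)`-valued points of the Hopf algebra `A′` (★ `coordMulEquiv`).
[cite: Tate1997FiniteFlatGroupSchemes, §(3.8) p. 145] -/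
def cartierDualPointsMulEquiv : letI := cartierDualGrpObj G; (T ⟶ cartierDual G) ≃* WithConv (DualAlg G →ₐ[R] Alg T) :=
  coordMulEquiv R (DualAlg G) T

variable {T} in
/-- `cartierDualPointsMulEquiv` is `coord` (★ p845155). [cite: Tate1997FiniteFlatGroupSchemes, §(3.8) p. 145] -/
theorem cartierDualPointsMulEquiv_apply (x : T ⟶ cartierDual G) :
    letI := cartierDualGrpObj G; cartierDualPointsMulEquiv G T x = toConv (coord x) := rfl

variable {R' : Type u} [CommRing R'] [Algebra R R']

/-- **The character reading of affine points of `G^D`** ([Tate1997FiniteFlatGroupSchemes] p. 145: «`G^D(S)` is the group of group-like elements of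
`A ⊗_R S` = `Hom_{S-gr}(G_S, 𝔾_{m,S})`»): for the evaluation pairing `Φ : R′ ⊗ A → (A′ → R′)`, `Φ (s ⊗ a) f = f(a) s` (it exists and is unique,
★ `exists_dualPairing ∕ dualPairing_unique`), every point `u : Spec R′ → G^D` over `R` — read as the algebra map `ψ_u : A′ → R′` through
`Γ(G^D) ≅ A′` — is `Φ x` for a UNIQUE element `x ∈ R′ ⊗_R Γ(G, 𝒪_G)`, and that `x` is GROUP-LIKE (★ CD2-pts `existsUnique_isGroupLikeElem_of_algHom`).
[cite: Tate1997FiniteFlatGroupSchemes, §(3.8) p. 145] -/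
theorem existsUnique_isGroupLikeElem_of_point (Φ : R' ⊗[R] Alg G →ₗ[R] Module.Dual R (Alg G) →ₗ[R] R')
    (hΦ : ∀ (s : R') (a : Alg G) (f : Module.Dual R (Alg G)), Φ (s ⊗ₜ a) f = f a • s)
    (u : specOver R R' ⟶ cartierDual G) :
    haveI := isAffine_cartierDual_left G
    ∃! x : R' ⊗[R] Alg G, IsGroupLikeElem R' x ∧
      ∀ f : WithConv (Module.Dual R (Alg G)),
        ((ptEquiv (cartierDual G) R' u).comp (algCartierDualEquiv G).symm.toAlgHom) f = Φ x f.ofConv :=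
  haveI := isAffine_cartierDual_left G
  existsUnique_isGroupLikeElem_of_algHom (Module.Free.chooseBasis R (Alg G)) Φ hΦ _

omit [Module.Free R (Alg G)] [Module.Finite R (Alg G)] in
/-- **Conversely, every group-like `x ∈ R′ ⊗_R Γ(G, 𝒪_G)` (a character of `G_{R′}`) is a point of `G^D` over `R′`** with algebra map `Φ x`
(★ CD2-pts `existsUnique_algHom_of_isGroupLikeElem`, then ★ `ptEquiv` backwards). [cite: Tate1997FiniteFlatGroupSchemes, §(3.8) p. 145] -/
theorem exists_point_of_isGroupLikeElem (Φ : R' ⊗[R] Alg G →ₗ[R] Module.Dual R (Alg G) →ₗ[R] R')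
    (hΦ : ∀ (s : R') (a : Alg G) (f : Module.Dual R (Alg G)), Φ (s ⊗ₜ a) f = f a • s)
    {x : R' ⊗[R] Alg G} (hx : IsGroupLikeElem R' x) :
    haveI := isAffine_cartierDual_left G
    ∃ u : specOver R R' ⟶ cartierDual G,
      ∀ f : WithConv (Module.Dual R (Alg G)),
        ((ptEquiv (cartierDual G) R' u).comp (algCartierDualEquiv G).symm.toAlgHom) f = Φ x f.ofConv := by
  haveI := isAffine_cartierDual_left G
  obtain ⟨ψ, hψ, -⟩ := existsUnique_algHom_of_isGroupLikeElem Φ hΦ hx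
  refine ⟨(ptEquiv (cartierDual G) R').symm (ψ.comp (algCartierDualEquiv G).toAlgHom), fun f => ?_⟩
  rw [Equiv.apply_symm_apply, AlgHom.comp_assoc, AlgEquiv.comp_symm, AlgHom.comp_id]
  exact hψ f

end Points

/-! ## §6 (ED. 2) Instances on `G^D`, so that `(G^D)^D`, `G^D ×_R G^D`, … elaborate without `letI` -/

/-- `A′` is free (instance form of ★ `DualAlg.free`). [cite: Tate1997FiniteFlatGroupSchemes, §(3.8) p. 144] -/
instance DualAlg.instFree : Module.Free R (DualAlg G) := DualAlg.free G

/-- `A′` is finite (instance form of ★ `DualAlg.finite`). [cite: Tate1997FiniteFlatGroupSchemes, §(3.8) p. 144] -/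
instance DualAlg.instFinite : Module.Finite R (DualAlg G) := DualAlg.finite G

/-- `A′` is cocommutative (instance form of ★ `DualAlg.isCocomm`). [cite: Tate1997FiniteFlatGroupSchemes, §(3.8) p. 145] -/
instance DualAlg.instIsCocomm : Coalgebra.IsCocomm R (DualAlg G) := DualAlg.isCocomm G

/-- **The group scheme `G^D`** as an instance (= ★ `cartierDualGrpObj G`, by `rfl`). [cite: Tate1997FiniteFlatGroupSchemes, §(3.8) p. 145] -/
instance cartierDual.instGrpObj : GrpObj (cartierDual G) := cartierDualGrpObj G

/-- The instance IS `cartierDualGrpObj G`. [cite: Tate1997FiniteFlatGroupSchemes, §(3.8) p. 145] -/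
theorem cartierDual.instGrpObj_eq : cartierDual.instGrpObj G = cartierDualGrpObj G := rfl

/-- `G^D` is commutative (instance form of ★ `isCommMonObj_cartierDual`). [cite: Tate1997FiniteFlatGroupSchemes, §(3.8) p. 145] -/
instance cartierDual.instIsCommMonObj : IsCommMonObj (cartierDual G) := isCommMonObj_cartierDual G

/-- `G^D` is affine (instance form of ★ `isAffine_cartierDual_left`). [cite: Tate1997FiniteFlatGroupSchemes, §(3.8) p. 145] -/
instance cartierDual.instIsAffineLeft : IsAffine (cartierDual G).left := isAffine_cartierDual_left G

/-- `Γ(G^D, 𝒪)` is free (instance form of ★ `free_alg_cartierDual`). [cite: Tate1997FiniteFlatGroupSchemes, §(3.8) p. 145] -/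
instance cartierDual.instFreeAlg : Module.Free R (Alg (cartierDual G)) := free_alg_cartierDual G

/-- `Γ(G^D, 𝒪)` is finite (instance form of ★ `finite_alg_cartierDual`). [cite: Tate1997FiniteFlatGroupSchemes, §(3.8) p. 145] -/
instance cartierDual.instFiniteAlg : Module.Finite R (Alg (cartierDual G)) := finite_alg_cartierDual G

/-- `G^D → Spec R` is finite (instance form). [cite: Tate1997FiniteFlatGroupSchemes, §(3.8) p. 145] -/
instance cartierDual.instIsFiniteHom : IsFinite (cartierDual G).hom := isFinite_cartierDual_hom G

/-- `G^D → Spec R` is flat (instance form). [cite: Tate1997FiniteFlatGroupSchemes, §(3.8) p. 145] -/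
instance cartierDual.instFlatHom : Flat (cartierDual G).hom := flat_cartierDual_hom G

/-- **The bidual `(G^D)^D` elaborates**: `cartierDual (cartierDual G) : SchemeOver R`, with its group structure found by instance search.
[cite: Tate1997FiniteFlatGroupSchemes, §(3.8) p. 145] -/
theorem cartierDual_cartierDual_def : cartierDual (cartierDual G) = specOver R (DualAlg (cartierDual G)) := rfl

end AffineGroupScheme

end Literature.AlgebraicGeometry.GroupSchemes

end
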